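import Mathlib.Analysis.InnerProductSpace.PiL2
import Mathlib.Analysis.Calculus.Deriv.Mul
import Mathlib.Analysis.Calculus.Deriv.Prod
import Mathlib.Algebra.BigOperators.Fin
import Mathlib.Data.Fin.Tuple.Basic
import Literature.Analysis.ODE.CarlemanTruncationDissipative
import HarnessLib

/-!
# Carleman linearisation: the Kronecker transfer blocks and Corollary 1 in `ℝⁿ`

Liu–Kolden–Krovi–Loureiro–Trivisa–Childs, *Efficient quantum algorithm for dissipative nonlinear
differential equations*, PNAS 118 (2021) e2026805118 = arXiv:2011.03185 [LiuEtAl2021Carleman], §3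
(Carleman linearisation of `du/dt = F₂ u^{⊗2} + F₁ u`, `u ∈ ℝⁿ`, `F₂ ∈ ℝ^{n × n²}`: variables
`ŷ_j ≈ u^{⊗j} ∈ ℝ^{n^j}`, transfer matrices `A_j^j = Σ_ν I ⊗ ⋯ ⊗ F₁ ⊗ ⋯ ⊗ I ∈ ℝ^{n^j × n^j}` and
`A_{j+1}^j = Σ_ν I ⊗ ⋯ ⊗ F₂ ⊗ ⋯ ⊗ I ∈ ℝ^{n^j × n^{j+1}}`, eqs. (3.2)–(3.6)) and §4.1.1 Corollary 1
(`F₀ = 0`, `R = ‖u_in‖‖F₂‖/|Re λ₁| < 1` ⇒ `‖u^{⊗j}(t) − ŷ_j(t)‖ ≤ ‖u_in‖^j R^{N+1−j}`).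

This file supplies the CONCRETE Kronecker realisation that
`Literature.Analysis.ODE.CarlemanTruncationDissipative` leaves as hypotheses (D), (C), (K), and
derives Corollary 1 in `ℝⁿ` from the abstract chain theorem proved there:

* `kronPow j v : (Fin j → n) → ℝ`, `(v^{⊗j})_m = ∏_i v_{m i}` — the Carleman variable `u^{⊗j}` as a
  function of `j` indices; `kronSq v (k,l) = v_k v_l`;
* `transferDiag j F₁` (= `A_j^j`) and `transferUp j F₂` (= `A_{j+1}^j`) as linear maps on these
  function spaces (`F₁ : Matrix n n ℝ`, `F₂ : Matrix n (n × n) ℝ`);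
* `hasDerivAt_kronPow` — the EXACT infinite Carleman system: `u' = F₁u + F₂(u ⊗ u)` implies
  `d(u^{⊗j})/dt = A_j^j u^{⊗j} + A_{j+1}^j u^{⊗(j+1)}` (product rule; eqs. (3.2)–(3.6));
* (D) `dotProduct_transferDiag_le` / `inner_liftL2_transferDiag_le`: `xᵀF₁x ≤ μ xᵀx` on `ℝⁿ`
  implies `yᵀA_j^jy ≤ jμ yᵀy` on `ℝ^{n^j}` (fibrewise; the paper's
  `η_j†[A_j^j + (A_j^j)†]η_j ≤ 2jRe(λ₁)‖η_j‖²`, p0009 L106, with `μ = Re λ₁` for its normal `F₁`);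
* (C) `sum_sq_transferUpAt_le` / `norm_liftL2_transferUp_le`: `‖F₂z‖ ≤ c‖z‖` implies
  `‖A_{j+1}^j w‖ ≤ j c ‖w‖` (fibrewise + triangle inequality; the paper's `‖A_{j+1}^j‖ = j‖F₂‖`);
* (K) `norm_toLp_kronPow`: `‖u^{⊗j}‖ = ‖u‖^j` (Euclidean norms; `Finset.sum_pow'`);
* `kron_truncation_error_le_of_R_lt_one` — **Corollary 1 (first bound) in `ℝⁿ`**: for ANY
  `u : [0,∞) → ℝⁿ` with `u' = F₁u + F₂(u ⊗ u)` (`HasDerivAt`), `xᵀF₁x ≤ μxᵀx` (`μ < 0`),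
  `‖F₂z‖ ≤ c‖z‖`, `R := ‖u(0)‖c/|μ| < 1`, `u(0) ≠ 0`, and ANY solution `ŷ` of the truncated system
  `ŷ_j' = A_j^jŷ_j + A_{j+1}^jŷ_{j+1}` (`ŷ_{N+1} ≡ 0`, `ŷ_j(0) = u(0)^{⊗j}`):
  `‖u(t)^{⊗j} − ŷ_j(t)‖ ≤ ‖u(0)‖^j R^{N+1−j}` for `1 ≤ j ≤ N`, `t ≥ 0`.

Euclidean norms are written `‖toLp 2 x‖` (`EuclideanSpace ℝ _`); hypotheses on `F₁`, `F₂` are in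
`dotProduct` form so that users can supply matrices. Slot conventions: in `A_{j+1}^j` the pair
index replacing slot `i` occupies slots `i, i+1` (`insPair`); any other placement convention gives
the same three facts. Not formalised here: Lemma 2 (inhomogeneous `F₀ ≠ 0`), the sharper `j = 1`
factor `(1 − e^{Re λ₁ t})^N`, and the identification `μ = Re λ₁(F₁)` for normal `F₁` (we keep the
quadratic-form hypothesis the printed proof uses).

## References

* J.-P. Liu, H. Ø. Kolden, H. K. Krovi, N. F. Loureiro, K. Trivisa, A. M. Childs, *Efficient
  quantum algorithm for dissipative nonlinear differential equations*, PNAS 118 (35) (2021),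
  arXiv:2011.03185, §3 eqs. (3.2)–(3.6) and §4.1.1 Corollary 1. [LiuEtAl2021Carleman]
* M. Forets, A. Pouly, *Explicit error bounds for Carleman linearization*, arXiv:1711.02552
  (2017), §2 (transfer matrices), Thm. 4.2. [ForetsPouly2017]
-/

noncomputable section

open Finset Matrix WithLp
open scoped InnerProductSpace

namespace Literature.Analysis.ODE.Carleman

variable {n : Type*} [Fintype n]

/-- The `j`-th Kronecker power of a vector as a function on multi-indices:
`(v^{⊗j})_m = ∏_{i<j} v_{m i}` for `m : Fin j → n`.
[cite: LiuEtAl2021Carleman, §3 eq. (3.2) (Carleman variables ŷ_j = u^{⊗j})] -/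
def kronPow (j : ℕ) (v : n → ℝ) : (Fin j → n) → ℝ := fun m => ∏ i, v (m i)

/-- The Kronecker square `u^{⊗2}` indexed by pairs: `(u ⊗ u)_{(k,l)} = u_k u_l` (the argument of
`F₂` in `du/dt = F₂ u^{⊗2} + F₁ u`). [cite: LiuEtAl2021Carleman, Problem 1 / eq. (2.1)] -/
def kronSq (v : n → ℝ) : n × n → ℝ := fun p => v p.1 * v p.2

/-- The diagonal transfer block `A_j^j = Σ_{i<j} I ⊗ ⋯ ⊗ F₁ ⊗ ⋯ ⊗ I` (`F₁` in the `i`-th slot)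
acting on functions of `j` indices: `(A_j^j y)_m = Σ_i Σ_k (F₁)_{m_i k} y_{m[i ↦ k]}`.
[cite: LiuEtAl2021Carleman, §3 eq. (3.5) (definition of A_j^j)] -/
def transferDiag (j : ℕ) (F₁ : Matrix n n ℝ) : ((Fin j → n) → ℝ) →ₗ[ℝ] ((Fin j → n) → ℝ) where
  toFun y m := ∑ i, ∑ k, F₁ (m i) k * y (Function.update m i k)
  map_add' y z := by
    ext m
    simp only [Pi.add_apply, mul_add, sum_add_distrib]
  map_smul' c y := by
    ext m
    simp only [Pi.smul_apply, smul_eq_mul, RingHom.id_apply, mul_sum, mul_left_comm]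

/-- The multi-index obtained from `m : Fin j → n` by replacing its `i`-th entry with the PAIR
`(k, l)` (at positions `i`, `i+1`) — the index bookkeeping of `I ⊗ ⋯ ⊗ F₂ ⊗ ⋯ ⊗ I` acting on
`u^{⊗(j+1)}`. [cite: LiuEtAl2021Carleman, §3 eq. (3.4) (A_{j+1}^j), index convention] -/
def insPair {j : ℕ} (i : Fin j) (k l : n) (m : Fin j → n) : Fin (j + 1) → n :=
  Fin.insertNth i.castSucc k (Function.update m i l)

/-- The super-diagonal transfer block `A_{j+1}^j = Σ_{i<j} I ⊗ ⋯ ⊗ F₂ ⊗ ⋯ ⊗ I` (`F₂ : ℝ^{n²} → ℝⁿ`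
in the `i`-th slot) mapping functions of `j+1` indices to functions of `j` indices:
`(A_{j+1}^j w)_m = Σ_i Σ_{(k,l)} (F₂)_{m_i,(k,l)} w_{insPair i k l m}`.
[cite: LiuEtAl2021Carleman, §3 eq. (3.4) (definition of A_{j+1}^j)] -/
def transferUp (j : ℕ) (F₂ : Matrix n (n × n) ℝ) :
    ((Fin (j + 1) → n) → ℝ) →ₗ[ℝ] ((Fin j → n) → ℝ) where
  toFun w m := ∑ i, ∑ p : n × n, F₂ (m i) p * w (insPair i p.1 p.2 m)
  map_add' w z := by
    ext m
    simp only [Pi.add_apply, mul_add, sum_add_distrib]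
  map_smul' c w := by
    ext m
    simp only [Pi.smul_apply, smul_eq_mul, RingHom.id_apply, mul_sum, mul_left_comm]

omit [Fintype n] in
/-- `∏_{i'} v_{m[i ↦ k] i'} = v_k ∏_{i' ≠ i} v_{m i'}`. [folklore] -/
private theorem prod_update_eq {j : ℕ} (v : n → ℝ) (m : Fin j → n) (i : Fin j) (k : n) :
    ∏ i', v (Function.update m i k i') = v k * ∏ i' ∈ univ.erase i, v (m i') := by
  have h : (fun i' => v (Function.update m i k i')) =
      Function.update (fun i' => v (m i')) i (v k) := by
    funext i'
    exact Function.apply_update (fun _ => v) m i k i'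
  rw [h, prod_update_of_mem (mem_univ i), sdiff_singleton_eq_erase]

omit [Fintype n] in
/-- `∏_{i''} v_{(insPair i k l m) i''} = v_k v_l ∏_{i' ≠ i} v_{m i'}`. [folklore] -/
private theorem prod_insPair_eq {j : ℕ} (v : n → ℝ) (m : Fin j → n) (i : Fin j) (k l : n) :
    ∏ i'', v (insPair i k l m i'') = v k * (v l * ∏ i' ∈ univ.erase i, v (m i')) := by
  rw [Fin.prod_univ_succAbove _ i.castSucc]
  simp only [insPair, Fin.insertNth_apply_same, Fin.insertNth_apply_succAbove]
  rw [prod_update_eq]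

/-- **The exact (infinite) Carleman system.** If `u' = F₁ u + F₂ u^{⊗2}` at `s`, then the Kronecker
powers satisfy `d(u^{⊗j})/dt = A_j^j u^{⊗j} + A_{j+1}^j u^{⊗(j+1)}` EXACTLY (product rule).
[cite: LiuEtAl2021Carleman, §3 eqs. (3.2)–(3.6) and the display (exact) on p0009] -/
theorem hasDerivAt_kronPow {u : ℝ → n → ℝ} {F₁ : Matrix n n ℝ} {F₂ : Matrix n (n × n) ℝ}
    {s : ℝ} (hu : HasDerivAt u (F₁ *ᵥ u s + F₂ *ᵥ kronSq (u s)) s) (j : ℕ) :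
    HasDerivAt (fun s => kronPow j (u s))
      (transferDiag j F₁ (kronPow j (u s)) + transferUp j F₂ (kronPow (j + 1) (u s))) s := by
  refine hasDerivAt_pi.2 fun m => ?_
  have hcomp : ∀ i ∈ (univ : Finset (Fin j)),
      HasDerivAt (fun s => u s (m i)) ((F₁ *ᵥ u s + F₂ *ᵥ kronSq (u s)) (m i)) s :=
    fun i _ => hasDerivAt_pi.1 hu (m i)
  have h := HasDerivAt.fun_finsetProd hcomp
  simp only [kronPow]
  refine h.congr_deriv ?_
  -- the algebraic identity behind (3.2)–(3.6)
  simp only [transferDiag, transferUp, LinearMap.coe_mk, AddHom.coe_mk, Pi.add_apply, kronPow,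
    prod_update_eq, prod_insPair_eq, mulVec, dotProduct, kronSq, smul_eq_mul]
  rw [← sum_add_distrib]
  refine sum_congr rfl fun i _ => ?_
  rw [mul_add, mul_sum, mul_sum]
  congr 1
  · exact sum_congr rfl fun k _ => by ring
  · exact sum_congr rfl fun p _ => by ring

/-! ### Fact (D): the diagonal blocks inherit the dissipativity of `F₁`, with constant `jμ` -/

omit [Fintype n] in
/-- Reindexing a sum over multi-indices `Fin (j+1) → n` by separating the `i`-th entry.
[folklore] -/
private theorem sum_eq_sum_insertNth {j : ℕ} [Fintype n] (i : Fin (j + 1))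
    (f : (Fin (j + 1) → n) → ℝ) :
    ∑ m, f m = ∑ r : Fin j → n, ∑ a : n, f (Fin.insertNth i a r) := by
  rw [← (Fin.insertNthEquiv (fun _ => n) i).sum_comp f, Fintype.sum_prod_type, sum_comm]
  rfl

/-- The `i`-th summand of `A_j^j` tested against `y`:
`Σ_m y_m Σ_k (F₁)_{m_i k} y_{m[i↦k]} ≤ μ Σ_m y_m²` whenever `xᵀF₁x ≤ μ xᵀx` on `ℝⁿ` — apply the
hypothesis fibrewise (fix all indices but the `i`-th); one slot of the paper's
`η_j†[A_j^j + (A_j^j)†]η_j ≤ 2jRe(λ₁)‖η_j‖²` (p0009 L106).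
[cite: LiuEtAl2021Carleman, §4.1.1 eq. (D), one slot] -/
theorem sum_mul_transferDiag_slot_le {j : ℕ} {F₁ : Matrix n n ℝ} {μ : ℝ}
    (hF₁ : ∀ x : n → ℝ, x ⬝ᵥ (F₁ *ᵥ x) ≤ μ * (x ⬝ᵥ x)) (i : Fin j) (y : (Fin j → n) → ℝ) :
    ∑ m, y m * ∑ k, F₁ (m i) k * y (Function.update m i k) ≤ μ * ∑ m, y m * y m := by
  cases j with
  | zero => exact i.elim0
  | succ j =>
    rw [sum_eq_sum_insertNth i, sum_eq_sum_insertNth i (fun m => y m * y m), mul_sum]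
    refine sum_le_sum fun r _ => ?_
    -- the fibre vector x_r a := y (insertNth i a r)
    have h := hF₁ (fun a => y (Fin.insertNth i a r))
    simp only [dotProduct, mulVec, Fin.update_insertNth, Fin.insertNth_apply_same] at h ⊢
    exact h

/-- **Fact (D).** `yᵀ A_j^j y ≤ jμ · yᵀy` for every `y : ℝ^{n^j}`, given `xᵀ F₁ x ≤ μ xᵀx` on `ℝⁿ`
(for the paper's NORMAL `F₁`, `μ = Re λ₁(F₁)`; in general `μ` = any bound on the logarithmic
2-norm, e.g. `λ_max` of the symmetric part); the paper's eq. (D) p0009 L106 and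
`‖e^{A_j^j t}‖ = e^{jRe(λ₁)t}` p0009 L229.
[cite: LiuEtAl2021Carleman, §4.1.1 eq. (D) and ‖e^{A_j^j t}‖ = e^{jRe(λ₁)t}] -/
theorem dotProduct_transferDiag_le {j : ℕ} {F₁ : Matrix n n ℝ} {μ : ℝ}
    (hF₁ : ∀ x : n → ℝ, x ⬝ᵥ (F₁ *ᵥ x) ≤ μ * (x ⬝ᵥ x)) (y : (Fin j → n) → ℝ) :
    y ⬝ᵥ (transferDiag j F₁ y) ≤ (j : ℝ) * μ * (y ⬝ᵥ y) := by
  have h : y ⬝ᵥ (transferDiag j F₁ y) =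
      ∑ i : Fin j, ∑ m, y m * ∑ k, F₁ (m i) k * y (Function.update m i k) := by
    simp only [dotProduct, transferDiag, LinearMap.coe_mk, AddHom.coe_mk, mul_sum]
    rw [sum_comm]
  rw [h]
  calc ∑ i : Fin j, ∑ m, y m * ∑ k, F₁ (m i) k * y (Function.update m i k)
      ≤ ∑ _i : Fin j, μ * (y ⬝ᵥ y) := sum_le_sum fun i _ => sum_mul_transferDiag_slot_le hF₁ i y
    _ = (j : ℝ) * μ * (y ⬝ᵥ y) := by simp [mul_assoc]

/-! ### Fact (C): `‖A_{j+1}^j‖ ≤ j‖F₂‖` -/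

/-- The `i`-th summand of `A_{j+1}^j`: `F₂` applied in the slot pair `(i, i+1)`, i.e. the term
`I^{⊗ i} ⊗ F₂ ⊗ I^{⊗(j-1-i)}`. [cite: LiuEtAl2021Carleman, §3 eq. (3.4), one summand] -/
def transferUpAt {j : ℕ} (F₂ : Matrix n (n × n) ℝ) (i : Fin j) (w : (Fin (j + 1) → n) → ℝ)
    (m : Fin j → n) : ℝ :=
  ∑ p : n × n, F₂ (m i) p * w (insPair i p.1 p.2 m)

omit [Fintype n] in
/-- `A_{j+1}^j = Σ_i (I^{⊗ i} ⊗ F₂ ⊗ I^{⊗(j-1-i)})`, componentwise.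
[cite: LiuEtAl2021Carleman, §3 eq. (3.4)] -/
theorem transferUp_apply {j : ℕ} [Fintype n] (F₂ : Matrix n (n × n) ℝ)
    (w : (Fin (j + 1) → n) → ℝ) (m : Fin j → n) :
    transferUp j F₂ w m = ∑ i, transferUpAt F₂ i w m := rfl

omit [Fintype n] in
/-- The index map `((k,l), r) ↦ insPair i k l (insertNth i a r)` does not depend on `a` and is the
bijection `(n × n) × (Fin j → n) ≃ (Fin (j+2) → n)` "insert the pair at slots `i, i+1`".
[folklore] -/
private theorem insPair_insertNth {j : ℕ} (i : Fin (j + 1)) (k l a : n) (r : Fin j → n) :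
    insPair i k l (Fin.insertNth i a r) = Fin.insertNth i.castSucc k (Fin.insertNth i l r) := by
  simp [insPair, Fin.update_insertNth]

omit [Fintype n] in
/-- The pair-insertion bijection. [folklore] -/
private def insPairEquiv {j : ℕ} (i : Fin (j + 1)) : (n × n) × (Fin j → n) ≃ (Fin (j + 2) → n) :=
  ((Equiv.prodAssoc n n (Fin j → n)).trans
    ((Equiv.refl n).prodCongr (Fin.insertNthEquiv (fun _ => n) i))).trans
    (Fin.insertNthEquiv (fun _ => n) i.castSucc)

/-- **Fact (C), one slot.** `‖(A_{j+1}^j)_i w‖² ≤ c² ‖w‖²` given `‖F₂ z‖² ≤ c²‖z‖²` on `ℝ^{n²}` —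
apply the hypothesis fibrewise; one slot of the paper's `‖A_{j+1}^j‖ = j‖F₂‖` (p0009 L229).
[cite: LiuEtAl2021Carleman, §4.1.1, ‖A_{j+1}^j‖ = j‖F₂‖, one slot] -/
theorem sum_sq_transferUpAt_le {j : ℕ} {F₂ : Matrix n (n × n) ℝ} {c : ℝ}
    (hF₂ : ∀ z : n × n → ℝ, (F₂ *ᵥ z) ⬝ᵥ (F₂ *ᵥ z) ≤ c ^ 2 * (z ⬝ᵥ z)) (i : Fin j)
    (w : (Fin (j + 1) → n) → ℝ) :
    ∑ m, transferUpAt F₂ i w m * transferUpAt F₂ i w m ≤ c ^ 2 * ∑ M, w M * w M := by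
  cases j with
  | zero => exact i.elim0
  | succ j =>
    rw [sum_eq_sum_insertNth i]
    -- fibre vectors z_r p := w (insertNth i.castSucc p.1 (insertNth i p.2 r))
    have hfib : ∀ r : Fin j → n,
        ∑ a, transferUpAt F₂ i w (Fin.insertNth i a r) * transferUpAt F₂ i w (Fin.insertNth i a r)
          ≤ c ^ 2 * ∑ p : n × n, w (Fin.insertNth i.castSucc p.1 (Fin.insertNth i p.2 r)) *
              w (Fin.insertNth i.castSucc p.1 (Fin.insertNth i p.2 r)) := by
      intro r
      have h := hF₂ (fun p => w (Fin.insertNth i.castSucc p.1 (Fin.insertNth i p.2 r)))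
      simp only [dotProduct, mulVec, transferUpAt, insPair_insertNth,
        Fin.insertNth_apply_same] at h ⊢
      exact h
    refine (sum_le_sum fun r _ => hfib r).trans ?_
    rw [← mul_sum, ← Fintype.sum_prod_type_right' ]
    rw [← (insPairEquiv i).sum_comp (fun M => w M * w M)]
    exact le_rfl

/-! ### Fact (K): `‖u^{⊗j}‖ = ‖u‖^j` (Euclidean norms) -/

/-- `Σ_m (u^{⊗j})_m² = (Σ_k u_k²)^j` (the paper's `‖u^{⊗(N+1)}‖ = ‖u‖^{N+1}`, proof of Cor. 1).
[cite: LiuEtAl2021Carleman, §4.1.1, proof of Corollary 1] -/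
theorem sum_kronPow_mul_self (j : ℕ) (v : n → ℝ) :
    ∑ m, kronPow j v m * kronPow j v m = (∑ k, v k * v k) ^ j := by
  classical
  simp only [kronPow, ← prod_mul_distrib]
  have h := Finset.sum_pow' (univ : Finset n) (fun k => v k * v k) j
  rw [Fintype.piFinset_univ] at h
  exact h.symm

/-- `‖toLp 2 x‖² = x ⬝ᵥ x` on `EuclideanSpace ℝ ι`. [folklore] -/
private theorem norm_toLp_sq {ι : Type*} [Fintype ι] (x : ι → ℝ) :
    ‖(toLp 2 x : EuclideanSpace ℝ ι)‖ ^ 2 = x ⬝ᵥ x := by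
  rw [EuclideanSpace.real_norm_sq_eq]
  simp [dotProduct, pow_two]

/-- **Fact (K).** `‖u^{⊗j}‖ = ‖u‖^j` for the Euclidean norms on `ℝ^{n^j}` and `ℝⁿ`.
[cite: LiuEtAl2021Carleman, §4.1.1, proof of Corollary 1 (`‖u^{⊗(N+1)}‖ = ‖u‖^{N+1}`)] -/
theorem norm_toLp_kronPow (j : ℕ) (v : n → ℝ) :
    ‖(toLp 2 (kronPow j v) : EuclideanSpace ℝ (Fin j → n))‖ =
      ‖(toLp 2 v : EuclideanSpace ℝ n)‖ ^ j := by
  have h1 : ‖(toLp 2 (kronPow j v) : EuclideanSpace ℝ (Fin j → n))‖ ^ 2 =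
      (‖(toLp 2 v : EuclideanSpace ℝ n)‖ ^ j) ^ 2 := by
    rw [norm_toLp_sq, ← pow_mul, mul_comm, pow_mul, norm_toLp_sq]
    exact sum_kronPow_mul_self j v
  exact (pow_left_inj₀ (norm_nonneg _) (by positivity) two_ne_zero).mp h1

/-! ### The blocks as linear maps of Euclidean spaces; Corollary 1 in `ℝⁿ` -/

/-- A linear map between function spaces, read on their Euclidean (`L²`) copies
`EuclideanSpace ℝ _` — the transfer matrices act on `ℝ^{n^j}` with the 2-norm, the norm in which
the paper states `‖e^{A_j^j t}‖ = e^{jRe(λ₁)t}` and `‖A_{j+1}^j‖ = j‖F₂‖`.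
[cite: LiuEtAl2021Carleman, §4.1.1 (2-norms of the transfer matrices, p0009 L229)] -/
def liftL2 {α β : Type*} (T : (α → ℝ) →ₗ[ℝ] (β → ℝ)) :
    EuclideanSpace ℝ α →ₗ[ℝ] EuclideanSpace ℝ β :=
  (WithLp.linearEquiv 2 ℝ (β → ℝ)).symm.toLinearMap ∘ₗ T ∘ₗ
    (WithLp.linearEquiv 2 ℝ (α → ℝ)).toLinearMap

omit [Fintype n] in
/-- `liftL2 T x = toLp (T (ofLp x))`. [cite: LiuEtAl2021Carleman, §4.1.1 (see `liftL2`)] -/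
theorem liftL2_apply {α β : Type*} (T : (α → ℝ) →ₗ[ℝ] (β → ℝ)) (x : EuclideanSpace ℝ α) :
    liftL2 T x = toLp 2 (T (ofLp x)) := rfl

/-- `⟪x, y⟫ = ofLp x ⬝ᵥ ofLp y` and `‖x‖² = ofLp x ⬝ᵥ ofLp x` on real Euclidean space. [folklore] -/
private theorem real_inner_eq_dotProduct {ι : Type*} [Fintype ι] (x y : EuclideanSpace ℝ ι) :
    ⟪x, y⟫_ℝ = ofLp x ⬝ᵥ ofLp y := by
  rw [EuclideanSpace.inner_eq_star_dotProduct, star_trivial, dotProduct_comm]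

/-- `‖x‖² = ofLp x ⬝ᵥ ofLp x` on real Euclidean space. [folklore] -/
private theorem norm_sq_eq_dotProduct {ι : Type*} [Fintype ι] (x : EuclideanSpace ℝ ι) :
    ‖x‖ ^ 2 = ofLp x ⬝ᵥ ofLp x := by
  rw [← real_inner_self_eq_norm_sq, real_inner_eq_dotProduct]

/-- **Fact (D) on `EuclideanSpace`.** The lifted diagonal block `A_j^j` is dissipative with constant
`jμ`. [cite: LiuEtAl2021Carleman, §4.1.1 eq. (D), p0009 L106] -/
theorem inner_liftL2_transferDiag_le {j : ℕ} {F₁ : Matrix n n ℝ} {μ : ℝ}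
    (hF₁ : ∀ x : n → ℝ, x ⬝ᵥ (F₁ *ᵥ x) ≤ μ * (x ⬝ᵥ x))
    (x : EuclideanSpace ℝ (Fin j → n)) :
    ⟪x, liftL2 (transferDiag j F₁) x⟫_ℝ ≤ (j : ℝ) * μ * ‖x‖ ^ 2 := by
  rw [real_inner_eq_dotProduct, norm_sq_eq_dotProduct, liftL2_apply, ofLp_toLp]
  exact dotProduct_transferDiag_le hF₁ (ofLp x)

/-- **Fact (C) on `EuclideanSpace`.** `‖A_{j+1}^j w‖ ≤ j c ‖w‖` when `‖F₂ z‖ ≤ c‖z‖`.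
[cite: LiuEtAl2021Carleman, §4.1.1, `‖A_{j+1}^j‖ = j‖F₂‖`, p0009 L229] -/
theorem norm_liftL2_transferUp_le {j : ℕ} {F₂ : Matrix n (n × n) ℝ} {c : ℝ} (hc : 0 ≤ c)
    (hF₂ : ∀ z : n × n → ℝ, (F₂ *ᵥ z) ⬝ᵥ (F₂ *ᵥ z) ≤ c ^ 2 * (z ⬝ᵥ z))
    (x : EuclideanSpace ℝ (Fin (j + 1) → n)) :
    ‖liftL2 (transferUp j F₂) x‖ ≤ (j : ℝ) * c * ‖x‖ := by
  -- split A_{j+1}^j into its j slots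
  have hsplit : liftL2 (transferUp j F₂) x =
      ∑ i : Fin j, (toLp 2 (transferUpAt F₂ i (ofLp x)) : EuclideanSpace ℝ (Fin j → n)) := by
    rw [liftL2_apply, ← WithLp.toLp_sum]
    congr 1
    funext m
    rw [transferUp_apply, Finset.sum_apply]
  have hslot : ∀ i : Fin j,
      ‖(toLp 2 (transferUpAt F₂ i (ofLp x)) : EuclideanSpace ℝ (Fin j → n))‖ ≤ c * ‖x‖ := by
    intro i
    have h2 : ‖(toLp 2 (transferUpAt F₂ i (ofLp x)) : EuclideanSpace ℝ (Fin j → n))‖ ^ 2 ≤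
        (c * ‖x‖) ^ 2 := by
      rw [norm_toLp_sq, mul_pow, norm_sq_eq_dotProduct]
      exact sum_sq_transferUpAt_le hF₂ i (ofLp x)
    exact (pow_le_pow_iff_left₀ (norm_nonneg _) (by positivity) two_ne_zero).mp h2
  rw [hsplit]
  calc ‖∑ i : Fin j, (toLp 2 (transferUpAt F₂ i (ofLp x)) : EuclideanSpace ℝ (Fin j → n))‖
      ≤ ∑ i : Fin j, ‖(toLp 2 (transferUpAt F₂ i (ofLp x)) : EuclideanSpace ℝ (Fin j → n))‖ :=
        norm_sum_le _ _
    _ ≤ ∑ _i : Fin j, c * ‖x‖ := sum_le_sum fun i _ => hslot i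
    _ = (j : ℝ) * c * ‖x‖ := by simp [mul_assoc]

/-- Derivatives pass to the Euclidean copy. [folklore] -/
private theorem hasDerivAt_toLp {ι : Type*} [Fintype ι] {f : ℝ → ι → ℝ} {f' : ι → ℝ} {s : ℝ}
    (h : HasDerivAt f f' s) :
    HasDerivAt (fun s => (toLp 2 (f s) : EuclideanSpace ℝ ι)) (toLp 2 f') s :=
  ((PiLp.continuousLinearEquiv 2 ℝ (fun _ : ι => ℝ)).symm : (ι → ℝ) →L[ℝ] EuclideanSpace ℝ ι)
    |>.hasFDerivAt.comp_hasDerivAt s h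

/-- **Liu et al. Corollary 1 (first bound) in `ℝⁿ`, Kronecker form.** Let `u : [0,∞) → ℝⁿ` solve the
homogeneous quadratic ODE `u' = F₁ u + F₂ u^{⊗2}` with `xᵀF₁x ≤ μ xᵀx` (`μ < 0`; `μ = Re λ₁` for the
paper's normal `F₁`) and `‖F₂ z‖ ≤ c‖z‖`, and assume `R := ‖u(0)‖c/|μ| < 1`,
`u(0) ≠ 0`. Let `ŷ_1, …, ŷ_N` solve the TRUNCATED Carleman system
`ŷ_j' = A_j^j ŷ_j + A_{j+1}^j ŷ_{j+1}` (`ŷ_{N+1} ≡ 0`) with `ŷ_j(0) = u(0)^{⊗j}`. Then for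
`1 ≤ j ≤ N`, `t ≥ 0`: `‖u(t)^{⊗j} − ŷ_j(t)‖ ≤ ‖u(0)‖^j R^{N+1−j}` (Euclidean norms).
Obtained from the abstract chain theorem `truncation_error_norm_le_of_R_lt_one` with facts (D), (C),
(K) of this file. [cite: LiuEtAl2021Carleman, Corollary 1 (first bound)] -/
theorem kron_truncation_error_le_of_R_lt_one {u : ℝ → n → ℝ} {y : (j : ℕ) → ℝ → (Fin j → n) → ℝ}
    {F₁ : Matrix n n ℝ} {F₂ : Matrix n (n × n) ℝ} {μ c : ℝ} {N : ℕ} (hμ : μ < 0) (hc : 0 ≤ c)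
    (hF₁ : ∀ x : n → ℝ, x ⬝ᵥ (F₁ *ᵥ x) ≤ μ * (x ⬝ᵥ x))
    (hF₂ : ∀ z : n × n → ℝ, (F₂ *ᵥ z) ⬝ᵥ (F₂ *ᵥ z) ≤ c ^ 2 * (z ⬝ᵥ z))
    (hu : ∀ s, 0 ≤ s → HasDerivAt u (F₁ *ᵥ u s + F₂ *ᵥ kronSq (u s)) s)
    (hR : ‖(toLp 2 (u 0) : EuclideanSpace ℝ n)‖ * c / (-μ) < 1) (h0 : u 0 ≠ 0)
    (hy : ∀ j, 1 ≤ j → j ≤ N → ∀ s, 0 ≤ s →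
      HasDerivAt (y j) (transferDiag j F₁ (y j s) + transferUp j F₂ (y (j + 1) s)) s)
    (hyN : ∀ s, y (N + 1) s = 0)
    (hy0 : ∀ j, 1 ≤ j → j ≤ N → y j 0 = kronPow j (u 0))
    {j : ℕ} (hj1 : 1 ≤ j) (hjN : j ≤ N) {t : ℝ} (ht : 0 ≤ t) :
    ‖(toLp 2 (kronPow j (u t) - y j t) : EuclideanSpace ℝ (Fin j → n))‖ ≤
      ‖(toLp 2 (u 0) : EuclideanSpace ℝ n)‖ ^ j *
        (‖(toLp 2 (u 0) : EuclideanSpace ℝ n)‖ * c / (-μ)) ^ (N + 1 - j) := by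
  -- the chain data
  let E : ℕ → Type _ := fun j => EuclideanSpace ℝ (Fin j → n)
  let U : (j : ℕ) → ℝ → E j := fun j s => toLp 2 (kronPow j (u s))
  let Y : (j : ℕ) → ℝ → E j := fun j s => toLp 2 (y j s)
  let A : (j : ℕ) → E j →ₗ[ℝ] E j := fun j => liftL2 (transferDiag j F₁)
  let C : (j : ℕ) → E (j + 1) →ₗ[ℝ] E j := fun j => liftL2 (transferUp j F₂)
  have hU1 : ∀ s, ‖U 1 s‖ = ‖(toLp 2 (u s) : EuclideanSpace ℝ n)‖ := fun s => by
    show ‖(toLp 2 (kronPow 1 (u s)) : EuclideanSpace ℝ (Fin 1 → n))‖ = _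
    rw [norm_toLp_kronPow, pow_one]
  have hpow : ∀ j, 1 ≤ j → j ≤ N + 1 → ∀ s, 0 ≤ s → ‖U j s‖ ≤ ‖U 1 s‖ ^ j := by
    intro j _ _ s _
    rw [hU1 s]
    exact (norm_toLp_kronPow j (u s)).le
  have hUd : ∀ j, 1 ≤ j → j ≤ N → ∀ s, 0 ≤ s →
      HasDerivAt (U j) (A j (U j s) + C j (U (j + 1) s)) s := by
    intro j _ _ s hs
    have h := hasDerivAt_toLp (hasDerivAt_kronPow (hu s hs) j)
    refine h.congr_deriv ?_
    rw [WithLp.toLp_add]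
    rfl
  have hYd : ∀ j, 1 ≤ j → j ≤ N → ∀ s, 0 ≤ s →
      HasDerivAt (Y j) (A j (Y j s) + C j (Y (j + 1) s)) s := by
    intro j hj hjN s hs
    have h := hasDerivAt_toLp (hy j hj hjN s hs)
    refine h.congr_deriv ?_
    rw [WithLp.toLp_add]
    rfl
  have hYN : ∀ s, Y (N + 1) s = 0 := fun s => by simp [Y, hyN s]
  have hY0 : ∀ j, 1 ≤ j → j ≤ N → Y j 0 = U j 0 := fun j hj hjN => by
    simp [Y, U, hy0 j hj hjN]
  have hA : ∀ j, 1 ≤ j → j ≤ N → ∀ x : E j, ⟪x, A j x⟫_ℝ ≤ (j : ℝ) * μ * ‖x‖ ^ 2 :=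
    fun j _ _ x => inner_liftL2_transferDiag_le hF₁ x
  have hC : ∀ j, 1 ≤ j → j ≤ N → ∀ x : E (j + 1), ‖C j x‖ ≤ (j : ℝ) * c * ‖x‖ :=
    fun j _ _ x => norm_liftL2_transferUp_le hc hF₂ x
  have hR' : ‖U 1 0‖ * c / (-μ) < 1 := by rwa [hU1 0]
  have h0' : U 1 0 ≠ 0 := by
    rw [← norm_ne_zero_iff, hU1 0, norm_ne_zero_iff]
    intro h
    exact h0 ((WithLp.toLp_eq_zero 2).mp h)
  have main := truncation_error_norm_le_of_R_lt_one (E := E) hμ hc hA hC hUd hpow hR' h0' hYd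
    hYN hY0 hj1 hjN ht
  rw [hU1 0] at main
  simpa [U, Y, WithLp.toLp_sub] using main

end Literature.Analysis.ODE.Carleman
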